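import Literature.NumberTheory.ModularForms.ModPModularFormsSerreDerivative
import Literature.NumberTheory.Congruences.BernoulliKummerCongruence
import Mathlib.NumberTheory.ModularForms.EisensteinSeries.QExpansion
import HarnessLib

/-!
# `θ` maps `M̃_k(N)` to `M̃_{k+p+1}(N)` — the classical proof (Serre, Swinnerton-Dyer): DISCHARGE of the named fact `ModP.ThetaMem`

Topic `Literature/NumberTheory/ModularForms`, sub-namespace `ModP`. THEOREMS ONLY (no definition, no new named fact); this file
DISCHARGES `Literature.NumberTheory.ModularForms.ModP.ThetaMem p N` (`ModPModularFormsThetaFiltration.lean`, Fact B: "`θ = q d/dq` maps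
`M̃_k(N)` to `M̃_{k+p+1}(N)`", [Katz1977, Thm. (1)], [Jochnowitz1982, §1 Fact 1.4]) for every prime `p` and every `N`:
**`ThetaMem_holds : ThetaMem p N`** (the fact's own hypotheses `5 ≤ p`, `p ∤ N` are used).

THE ARGUMENT (Swinnerton-Dyer, LNM 350 §3, proof of Lemma 5 (i); Serre, LNM 350 §1.4, for level one — verbatim for `Γ₁(N)`). Let
`f ∈ M_k(Γ₁(N))` have rational `p`-integral `q`-expansion `Σ aₙ qⁿ` (`p ≥ 5`). With `ϑ_k f = Df − (k/12)E₂f ∈ M_{k+2}(Γ₁(N))` (Serre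
derivative; `ModPModularFormsSerreDerivative.lean`) and the level-one Eisenstein series `E_{p−1}`, `E_{p+1}` (Mathlib `EisensteinSeries.E`,
`q`-expansion `1 − (2κ/B_κ) Σ σ_{κ−1}(n) qⁿ`, `EisensteinSeries.E_qExpansion_coeff`):
`H := E_{p−1} · ϑ_k f + (k/12) · E_{p+1} · f ∈ M_{k+p+1}(Γ₁(N))` has rational `p`-integral coefficients, and modulo `p`
`E_{p−1} ≡ 1` (von Staudt–Clausen: `p B_{p−1} ≡ −1`, so `2(p−1)/B_{p−1} ∈ pℤ_(p)`), `E_{p+1} ≡ E₂` (Kummer: `B_{p+1}/(p+1) ≡ B₂/2 = 1/12`,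
so `2(p+1)/B_{p+1} ≡ 24`; Fermat: `σ_p(n) ≡ σ₁(n)`), whence `H ≡ θf − (k/12)E₂f + (k/12)E₂f = θf = Σ n aₙ qⁿ`.
Number-theoretic inputs by name: tree `KummerCongruence.kummer_congruence_one` (Ireland–Rosen Thm. 15.5),
`KummerCongruence.IrregularPrimes.padicValuation_prime_mul_bernoulli_add_one_le` (Cor. to Thm. 15.3, from Mathlib's
`Bernoulli.vonStaudt_clausen`), `ZMod.pow_card`.

* §1 bridge `Rat.padicValuation` ↔ `ℤ_p`, reduction mod `p` (`toZMod_eq_of_padicValuation_sub_le`, `exists_padicInt_seq_of_padicValuation_sub_le`);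
* §2 the three congruences: `padicValuation_eisenstein_coeff_sub_one` (`2(p−1)/B_{p−1} ∈ pℤ_(p)`),
  `padicValuation_eisenstein_coeff_add_one_le` / `…_sub_le` (`2(p+1)/B_{p+1} ∈ ℤ_(p)`, `≡ 24`), `natCast_sigma_prime_eq` (`σ_p ≡ σ₁`);
* §3 `exists_expansion_E_sub_one` (`E_{p−1} ≡ 1`), `exists_expansion_E_add_one` (`E_{p+1} ≡ E₂`) as rational `p`-integral expansions on `Γ₁(N)`;
* §4 `modPForms_le_modPForms_add` (`M̃_k(N) ⊆ M̃_{k+p−1}(N)`, by `E_{p−1} ≡ 1`) and **`ThetaMem_holds`**.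
* §5 `modPForms_le_modPForms_mul_level` (`M̃_k(N) ⊆ M̃_k(N·M)`, level raising; for users assembling forms at different levels).
beyond the printed statement: NO (this is the 1973 proof); the discharge makes `ModP.katzHypotheses`' `hΘ_mem` unconditional.

## References
* [SwinnertonDyer1973] §3, Lemma 5 (i) and (9) `θf = ϑf + (k/12)Pf` reduced mod `p` (`P = E₂`, `E_{p−1} ≡ 1`, `E_{p+1} ≡ E₂`).
* [Serre1973ZetaPadiques] §1.4 Thm. 5 (level one).
* [Katz1977] Thm. (1) (the statement discharged, for reductions of classical forms of level `Γ₁(N)`).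
* [IrelandRosen1982] Ch. 15 §1 Cor. to Thm. 3, §2 Thm. 5 (von Staudt–Clausen, Kummer).
* [Jochnowitz1982] §1 Fact 1.4 (first sentence).
-/

noncomputable section

open scoped Classical MatrixGroups ArithmeticFunction.sigma ModularForm
open UpperHalfPlane hiding I
open PowerSeries CongruenceSubgroup Function WithZero Finset EisensteinSeries
open Literature.NumberTheory.Congruences.KummerCongruence
open Literature.NumberTheory.Congruences.KummerCongruence.IrregularPrimes (padicValuation_prime_mul_bernoulli_add_one_le)
open Literature.NumberTheory.EllipticCurves.ModularForms (ofLevelOne)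

namespace Literature.NumberTheory.ModularForms.ModP

variable {p : ℕ} [hp : Fact p.Prime]


/-! ## §1 Bridge: `Rat.padicValuation` ↔ `ℤ_p` and reduction mod `p` -/

/-- A rational number of `p`-adic valuation `≤ 1` is a `p`-adic integer. [cite: IrelandRosen1982, Ch. 15 §2 (p-integers)] -/
theorem exists_padicInt_coe_eq_of_padicValuation_le_one {q : ℚ} (h : Rat.padicValuation p q ≤ 1) :
    ∃ x : ℤ_[p], (x : ℚ_[p]) = (q : ℚ_[p]) :=
  ⟨⟨(q : ℚ_[p]), Padic.norm_rat_le_one (Rat.padicValuation_le_one_iff.mp h)⟩, rfl⟩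

/-- If `q ≡ q' (mod p ℤ_(p))` (i.e. `v_p(q − q') ≤ exp(−1)`) then the `p`-adic integers they define have the same reduction mod `p`.
[cite: IrelandRosen1982, Ch. 15 §2 (p-integers, congruences mod p)] -/
theorem toZMod_eq_of_padicValuation_sub_le {q q' : ℚ} {x x' : ℤ_[p]} (hx : (x : ℚ_[p]) = (q : ℚ_[p]))
    (hx' : (x' : ℚ_[p]) = (q' : ℚ_[p])) (h : Rat.padicValuation p (q - q') ≤ exp (-1)) :
    PadicInt.toZMod x = PadicInt.toZMod x' := by
  have hr : Rat.padicValuation p ((q - q') / p) ≤ 1 := by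
    rw [map_div₀, Rat.padicValuation_self, div_le_one₀ (zero_lt_iff.2 exp_ne_zero)]
    exact h
  obtain ⟨r, hr'⟩ := exists_padicInt_coe_eq_of_padicValuation_le_one hr
  have hp0 : (p : ℚ_[p]) ≠ 0 := by exact_mod_cast hp.out.ne_zero
  have hxr : x - x' = (p : ℤ_[p]) * r := by
    apply Subtype.ext
    rw [PadicInt.coe_sub, PadicInt.coe_mul, PadicInt.coe_natCast, hx, hx', hr']
    push_cast
    field_simp
  rw [← sub_eq_zero, ← map_sub, hxr, map_mul, map_natCast, ZMod.natCast_self, zero_mul]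

/-- Integers have valuation `≤ 1`. [folklore] -/
private theorem padicValuation_intCast_le_one (z : ℤ) : Rat.padicValuation p (z : ℚ) ≤ 1 := by
  rw [Rat.padicValuation_cast]
  exact Int.padicValuation_le_one p z

/-! ## §2 The congruences: `E_{p−1} ≡ 1`, `E_{p+1} ≡ E₂`, `σ_p ≡ σ₁` -/

/-- `v_p(p · B_{p−1}) = 1` (von Staudt–Clausen: `p B_{p−1} ≡ −1 (mod p)`). [cite: IrelandRosen1982, Ch. 15 §1 Cor. to Thm. 3] -/
theorem padicValuation_prime_mul_bernoulli_sub_one (h5 : 5 ≤ p) :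
    Rat.padicValuation p ((p : ℚ) * bernoulli (p - 1)) = 1 := by
  have hev : Even (p - 1) := hp.out.even_sub_one (by omega)
  have h := padicValuation_prime_mul_bernoulli_add_one_le (p := p) hev (by omega) (dvd_refl _)
  have hlt : Rat.padicValuation p ((p : ℚ) * bernoulli (p - 1) + 1) < Rat.padicValuation p (1 : ℚ) := by
    rw [map_one]
    exact lt_of_le_of_lt h (by rw [← exp_zero, exp_lt_exp]; norm_num)
  have := Valuation.map_sub_eq_of_lt_right _ hlt
  rwa [add_sub_cancel_right, map_one] at this

/-- **`−2(p−1)/B_{p−1} ∈ p ℤ_(p)`** — the non-constant coefficients of `E_{p−1} = 1 − (2(p−1)/B_{p−1}) Σ σ_{p−2}(n) qⁿ` vanish mod `p`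
(von Staudt–Clausen). [cite: SwinnertonDyer1973, §3 (E_{p-1} ≡ 1 mod p)] -/
theorem padicValuation_eisenstein_coeff_sub_one (h5 : 5 ≤ p) :
    Rat.padicValuation p (2 * ((p - 1 : ℕ) : ℚ) / bernoulli (p - 1)) ≤ exp (-1) := by
  have hv := padicValuation_prime_mul_bernoulli_sub_one (p := p) h5
  have hpB : (p : ℚ) * bernoulli (p - 1) ≠ 0 := by
    intro h0
    rw [h0, map_zero] at hv
    exact zero_ne_one hv
  have hp0 : (p : ℚ) ≠ 0 := by exact_mod_cast hp.out.ne_zero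
  have hrw : 2 * ((p - 1 : ℕ) : ℚ) / bernoulli (p - 1) = ((2 * (p - 1 : ℕ) : ℤ) : ℚ) * p / ((p : ℚ) * bernoulli (p - 1)) := by
    push_cast
    field_simp
  rw [hrw, map_div₀, map_mul, hv, div_one, Rat.padicValuation_self]
  calc Rat.padicValuation p ((2 * (p - 1 : ℕ) : ℤ) : ℚ) * exp (-1) ≤ 1 * exp (-1) :=
        mul_le_mul' (padicValuation_intCast_le_one _) le_rfl
    _ = exp (-1) := one_mul _

/-- Kummer: `v_p(1/12 − B_{p+1}/(p+1)) ≤ exp(−1)` (`B_2/2 = 1/12`, `2 ≡ p + 1 (mod p − 1)`). [cite: IrelandRosen1982, Ch. 15 §2 Thm. 5] -/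
theorem padicValuation_twelve_inv_sub_bernoulli_div (h5 : 5 ≤ p) :
    Rat.padicValuation p (1 / 12 - bernoulli (p + 1) / ((p + 1 : ℕ) : ℚ)) ≤ exp (-1) := by
  have h2 : ¬ (p - 1) ∣ 2 := by
    intro h
    have := Nat.le_of_dvd (by norm_num) h
    omega
  have hmod : 2 ≡ p + 1 [MOD p - 1] := by
    rw [Nat.modEq_iff_dvd']
    · exact ⟨1, by omega⟩
    · omega
  have hk := kummer_congruence_one (p := p) even_two h2 hmod
  have hB2 : bernoulli 2 / ((2 : ℕ) : ℚ) = 1 / 12 := by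
    rw [bernoulli_two]
    norm_num
  rwa [hB2] at hk

/-- `v_p(B_{p+1}/(p+1)) = 1` (a `p`-adic unit, `≡ 1/12`). [cite: IrelandRosen1982, Ch. 15 §2 Thm. 5] -/
theorem padicValuation_bernoulli_div_add_one (h5 : 5 ≤ p) :
    Rat.padicValuation p (bernoulli (p + 1) / ((p + 1 : ℕ) : ℚ)) = 1 := by
  have h12 : Rat.padicValuation p (1 / 12 : ℚ) = 1 := by
    rw [one_div, map_inv₀, show (12 : ℚ) = ((12 : ℤ) : ℚ) by norm_num, Rat.padicValuation_cast,
      Int.padicValuation_eq_one_iff.mpr, inv_one]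
    intro h
    have h' : (p : ℤ) ∣ 12 := h
    have : p ∣ 12 := by exact_mod_cast h'
    have := Nat.le_of_dvd (by norm_num) this
    interval_cases p <;> first | omega | exact absurd hp.out (by decide)
  have hlt : Rat.padicValuation p (1 / 12 - bernoulli (p + 1) / ((p + 1 : ℕ) : ℚ)) <
      Rat.padicValuation p (1 / 12 : ℚ) := by
    rw [h12]
    exact lt_of_le_of_lt (padicValuation_twelve_inv_sub_bernoulli_div h5) (by rw [← exp_zero, exp_lt_exp]; norm_num)
  have key := Valuation.map_sub_eq_of_lt_right _ hlt
  rw [h12, show (1 / 12 - bernoulli (p + 1) / ((p + 1 : ℕ) : ℚ)) - 1 / 12 = -(bernoulli (p + 1) / ((p + 1 : ℕ) : ℚ)) by ring,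
    Valuation.map_neg] at key
  exact key

/-- **`2(p+1)/B_{p+1}` is `p`-integral** (Kummer: `B_{p+1}/(p+1)` is a `p`-unit). [cite: SwinnertonDyer1973, §3 (E_{p+1} ≡ E_2 mod p)] -/
theorem padicValuation_eisenstein_coeff_add_one_le (h5 : 5 ≤ p) :
    Rat.padicValuation p (2 * ((p + 1 : ℕ) : ℚ) / bernoulli (p + 1)) ≤ 1 := by
  have hu := padicValuation_bernoulli_div_add_one (p := p) h5
  have hu0 : bernoulli (p + 1) / ((p + 1 : ℕ) : ℚ) ≠ 0 := by
    intro h0; rw [h0, map_zero] at hu; exact zero_ne_one hu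
  have hrw : 2 * ((p + 1 : ℕ) : ℚ) / bernoulli (p + 1) = 2 / (bernoulli (p + 1) / ((p + 1 : ℕ) : ℚ)) := by
    have : ((p + 1 : ℕ) : ℚ) ≠ 0 := by positivity
    field_simp
  rw [hrw, map_div₀, hu, div_one, show (2 : ℚ) = ((2 : ℤ) : ℚ) by norm_num]
  exact padicValuation_intCast_le_one _

/-- **`2(p+1)/B_{p+1} ≡ 24 (mod p)`** — so `E_{p+1} ≡ E₂ = 1 − 24 Σ σ₁(n) qⁿ` coefficientwise once `σ_p ≡ σ₁`. [cite: SwinnertonDyer1973, §3 (E_{p+1} ≡ E_2 mod p)] -/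
theorem padicValuation_eisenstein_coeff_add_one_sub_le (h5 : 5 ≤ p) :
    Rat.padicValuation p (2 * ((p + 1 : ℕ) : ℚ) / bernoulli (p + 1) - 24) ≤ exp (-1) := by
  set u := bernoulli (p + 1) / ((p + 1 : ℕ) : ℚ) with hu_def
  have hu := padicValuation_bernoulli_div_add_one (p := p) h5
  have hu0 : u ≠ 0 := by
    intro h0; rw [← hu_def, h0, map_zero] at hu; exact zero_ne_one hu
  have hp1 : ((p + 1 : ℕ) : ℚ) ≠ 0 := by positivity
  have hB0 : bernoulli (p + 1) ≠ 0 := by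
    intro h0
    exact hu0 (by rw [hu_def, h0, zero_div])
  have hrw : 2 * ((p + 1 : ℕ) : ℚ) / bernoulli (p + 1) - 24 = ((24 : ℤ) : ℚ) * (1 / 12 - u) / u := by
    rw [hu_def]
    field_simp
    ring
  rw [hrw, map_div₀, map_mul, hu, div_one]
  calc Rat.padicValuation p ((24 : ℤ) : ℚ) * Rat.padicValuation p (1 / 12 - u)
      ≤ 1 * exp (-1) := mul_le_mul' (padicValuation_intCast_le_one _) (padicValuation_twelve_inv_sub_bernoulli_div h5)
    _ = exp (-1) := one_mul _

/-- Fermat: `σ_p(n) ≡ σ₁(n) (mod p)`. [cite: SwinnertonDyer1973, §3 (E_{p+1} ≡ E_2 mod p)] -/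
theorem natCast_sigma_prime_eq (n : ℕ) : ((σ p n : ℕ) : ZMod p) = ((σ 1 n : ℕ) : ZMod p) := by
  rw [ArithmeticFunction.sigma_apply, ArithmeticFunction.sigma_apply, Nat.cast_sum, Nat.cast_sum]
  refine sum_congr rfl fun d _ => ?_
  rw [Nat.cast_pow, pow_one, ZMod.pow_card]


/-- **Sequences.** If rationals `c m` are congruent mod `p ℤ_(p)` to integers `z m`, they are `p`-integral with reductions `z m mod p`: there
is `e : ℕ → ℤ_p` with `e m = c m` in `ℚ_p` and `e m mod p = z m`. [cite: IrelandRosen1982, Ch. 15 §2 (p-integers, congruences mod p)] -/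
theorem exists_padicInt_seq_of_padicValuation_sub_le {c : ℕ → ℚ} {z : ℕ → ℤ}
    (h : ∀ m, Rat.padicValuation p (c m - z m) ≤ exp (-1)) :
    ∃ e : ℕ → ℤ_[p], (∀ m, ((e m : ℤ_[p]) : ℚ_[p]) = (c m : ℚ_[p])) ∧ ∀ m, PadicInt.toZMod (e m) = (z m : ZMod p) := by
  have hc : ∀ m, Rat.padicValuation p (c m) ≤ 1 := fun m => by
    have := Valuation.map_add_le _ ((h m).trans (le_of_lt (by rw [← exp_zero, exp_lt_exp]; norm_num)))
      (padicValuation_intCast_le_one (p := p) (z m))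
    rwa [sub_add_cancel] at this
  choose e he using fun m => exists_padicInt_coe_eq_of_padicValuation_le_one (hc m)
  refine ⟨e, he, fun m => ?_⟩
  rw [← map_intCast (PadicInt.toZMod (p := p)) (z m)]
  exact toZMod_eq_of_padicValuation_sub_le (he m) (by rw [PadicInt.coe_intCast, Rat.cast_intCast]) (h m)

/-! ## §3 `E_{p−1} ≡ 1` and `E_{p+1} ≡ E₂` as rational `p`-integral expansions on `Γ₁(N)` -/

variable {N : ℕ}

/-- **`E_{p−1}|_{Γ₁(N)} ≡ 1 (mod p)`**: for `p ≥ 5`, the level-one Eisenstein series `E_{p−1} = 1 − (2(p−1)/B_{p−1}) Σ σ_{p−2}(n) qⁿ`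
(Mathlib `EisensteinSeries.E`, viewed on `Γ₁(N)`) has a rational `p`-integral expansion whose reduction is the constant `1`.
[cite: SwinnertonDyer1973, §3 (E_{p-1} ≡ 1 mod p)] -/
theorem exists_expansion_E_sub_one (h5 : 5 ≤ p) (h3 : 3 ≤ p - 1) :
    ∃ e : ℕ → ℤ_[p], HasRationalPIntegralQExpansion p (ofLevelOne (Gamma1 N) (ModularForm.E h3)) e ∧
      ∀ n, PadicInt.toZMod (e n) = if n = 0 then 1 else 0 := by
  have hev : Even (p - 1) := hp.out.even_sub_one (by omega)
  set c : ℕ → ℚ := fun m => if m = 0 then 1 else -(2 * ((p - 1 : ℕ) : ℚ) / bernoulli (p - 1)) * (σ (p - 1 - 1) m : ℕ) with hc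
  set z : ℕ → ℤ := fun m => if m = 0 then 1 else 0 with hz
  have hcz : ∀ m, Rat.padicValuation p (c m - z m) ≤ exp (-1) := by
    intro m
    by_cases hm : m = 0
    · simp [hc, hz, hm]
    · simp only [hc, hz, hm, ↓reduceIte, Int.cast_zero, sub_zero, neg_mul, Valuation.map_neg, map_mul]
      calc Rat.padicValuation p (2 * ((p - 1 : ℕ) : ℚ) / bernoulli (p - 1)) * Rat.padicValuation p ((σ (p - 1 - 1) m : ℕ) : ℚ)
          ≤ exp (-1) * 1 := mul_le_mul' (padicValuation_eisenstein_coeff_sub_one h5)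
            (by rw [← Int.cast_natCast]; exact padicValuation_intCast_le_one _)
        _ = exp (-1) := mul_one _
  obtain ⟨e, he, he'⟩ := exists_padicInt_seq_of_padicValuation_sub_le hcz
  refine ⟨e, HasRationalPIntegralQExpansion.ofLevelOne c (fun n => ?_) he, fun n => ?_⟩
  · rw [E_qExpansion_coeff h3 hev n]
    simp only [hc]
    split_ifs <;> push_cast <;> ring
  · rw [he' n, hz]
    dsimp only
    split_ifs <;> simp

/-- **`E_{p+1}|_{Γ₁(N)} ≡ E₂ (mod p)`**: for `p ≥ 5`, `E_{p+1} = 1 − (2(p+1)/B_{p+1}) Σ σ_p(n) qⁿ` on `Γ₁(N)` has a rational `p`-integral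
expansion whose reduction is `1 − 24 Σ σ₁(n) qⁿ mod p` (Kummer's congruence and `σ_p ≡ σ₁`).
[cite: SwinnertonDyer1973, §3 (E_{p+1} ≡ E_2 mod p)] -/
theorem exists_expansion_E_add_one (h5 : 5 ≤ p) (h3 : 3 ≤ p + 1) :
    ∃ e : ℕ → ℤ_[p], HasRationalPIntegralQExpansion p (ofLevelOne (Gamma1 N) (ModularForm.E h3)) e ∧
      ∀ n, PadicInt.toZMod (e n) = ((if n = 0 then 1 else -24 * (σ 1 n : ℤ) : ℤ) : ZMod p) := by
  have hev : Even (p + 1) := hp.out.even_sub_one (by omega) |>.add_one |> fun h => by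
    rcases hp.out.eq_two_or_odd' with h2 | hodd
    · omega
    · exact hodd.add_one
  set C : ℚ := 2 * ((p + 1 : ℕ) : ℚ) / bernoulli (p + 1) with hC
  set c : ℕ → ℚ := fun m => if m = 0 then 1 else -C * (σ (p + 1 - 1) m : ℕ) with hc
  set z : ℕ → ℤ := fun m => if m = 0 then 1 else -24 * (σ 1 m : ℤ) with hz
  have hσ : ∀ m, Rat.padicValuation p (((σ p m : ℕ) : ℚ) - ((σ 1 m : ℕ) : ℚ)) ≤ exp (-1) := by
    intro m
    have hdvd : (p : ℤ) ∣ ((σ p m : ℕ) : ℤ) - ((σ 1 m : ℕ) : ℤ) := by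
      rw [← ZMod.intCast_eq_intCast_iff_dvd_sub]
      push_cast
      exact (natCast_sigma_prime_eq m).symm
    obtain ⟨w, hw⟩ := hdvd
    have : (((σ p m : ℕ) : ℚ) - ((σ 1 m : ℕ) : ℚ)) = ((p : ℚ)) * (w : ℚ) := by exact_mod_cast hw
    rw [this, map_mul, Rat.padicValuation_self]
    calc exp (-1) * Rat.padicValuation p (w : ℚ) ≤ exp (-1) * 1 := mul_le_mul' le_rfl (padicValuation_intCast_le_one _)
      _ = exp (-1) := mul_one _
  have hcz : ∀ m, Rat.padicValuation p (c m - z m) ≤ exp (-1) := by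
    intro m
    by_cases hm : m = 0
    · simp [hc, hz, hm]
    · have hpm : p + 1 - 1 = p := by omega
      simp only [hc, hz, hm, ↓reduceIte, hpm]
      have hsplit : -C * ((σ p m : ℕ) : ℚ) - ((-24 * (σ 1 m : ℤ) : ℤ) : ℚ) =
          -((C - 24) * ((σ p m : ℕ) : ℚ) + ((24 : ℤ) : ℚ) * (((σ p m : ℕ) : ℚ) - ((σ 1 m : ℕ) : ℚ))) := by
        push_cast
        ring
      rw [hsplit, Valuation.map_neg]
      refine Valuation.map_add_le _ ?_ ?_
      · rw [map_mul]
        calc Rat.padicValuation p (C - 24) * Rat.padicValuation p ((σ p m : ℕ) : ℚ) ≤ exp (-1) * 1 :=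
              mul_le_mul' (padicValuation_eisenstein_coeff_add_one_sub_le h5)
                (by rw [← Int.cast_natCast]; exact padicValuation_intCast_le_one _)
          _ = exp (-1) := mul_one _
      · rw [map_mul]
        calc Rat.padicValuation p ((24 : ℤ) : ℚ) * Rat.padicValuation p (((σ p m : ℕ) : ℚ) - ((σ 1 m : ℕ) : ℚ))
            ≤ 1 * exp (-1) := mul_le_mul' (padicValuation_intCast_le_one _) (hσ m)
          _ = exp (-1) := one_mul _
  obtain ⟨e, he, he'⟩ := exists_padicInt_seq_of_padicValuation_sub_le hcz
  refine ⟨e, HasRationalPIntegralQExpansion.ofLevelOne c (fun n => ?_) he, he'⟩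
  rw [E_qExpansion_coeff h3 hev n]
  simp only [hc, hC]
  split_ifs <;> push_cast <;> ring

/-! ## §4 The discharge -/

/-- The indicator sum over the antidiagonal: `Σ_{i+j=n} [i = 0] F(j) = F(n)`. [folklore] -/
private theorem sum_antidiagonal_ite_mul {R : Type*} [Semiring R] (n : ℕ) (F : ℕ × ℕ → R) :
    ∑ ij ∈ antidiagonal n, (if ij.1 = 0 then (1 : R) else 0) * F ij = F (0, n) := by
  rw [Finset.sum_eq_single_of_mem (0, n) (by simp) fun ij hij hne => ?_]
  · simp
  · have h1 : ij.1 ≠ 0 := by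
      intro h0
      apply hne
      rw [HasAntidiagonal.mem_antidiagonal] at hij
      ext <;> simp <;> omega
    simp [h1]

/-- **`M̃_k(N) ⊆ M̃_{k+p−1}(N)`** — multiplication by `E_{p−1}|_{Γ₁(N)}`, whose expansion is `≡ 1 (mod p)` (the first half of
Jochnowitz's sentence "`M̃_k(N) ⊂ M̃_{k+l−1}(N)` for all weights `k`"; the Hasse invariant `A` in Katz's language), for `p ≥ 5`.
[cite: Jochnowitz1982, §1 p. 270 (after Def. 1.1)] -/
theorem modPForms_le_modPForms_add (h5 : 5 ≤ p) (k : ℕ) : modPForms p N k ≤ modPForms p N (k + (p - 1)) := by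
  intro g hg
  obtain ⟨f, x, hf, hgx⟩ := hg
  obtain ⟨eP, heP, heP'⟩ := exists_expansion_E_sub_one (N := N) h5 (by omega)
  have hw : ((p - 1 : ℕ) : ℤ) + (k : ℤ) = ((k + (p - 1) : ℕ) : ℤ) := by push_cast; ring
  refine ⟨_, _, (heP.mul hf).mcast hw, fun n => ?_⟩
  rw [hgx n]
  simp only [map_sum, map_mul, heP']
  rw [sum_antidiagonal_ite_mul]

/-- **DISCHARGE of Fact B (`ModP.ThetaMem`): `θ` maps `M̃_k(N)` to `M̃_{k+p+1}(N)`** for every prime `p ≥ 5` not dividing `N` —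
for `g = Σ (xₙ mod p) qⁿ ∈ M̃_k(N)` coming from `f ∈ M_k(Γ₁(N))`, the form `H = E_{p−1}·ϑ_k f + (k/12)·E_{p+1}·f ∈ M_{k+p+1}(Γ₁(N))`
has rational `p`-integral expansion reducing to `θ g = Σ n xₙ qⁿ` (module docstring). [cite: SwinnertonDyer1973, §3 Lemma 5 (i)] -/
theorem ThetaMem_holds : ∀ (p N : ℕ) [Fact p.Prime], ThetaMem p N := by
  intro p N hp h5 hpN k g hg
  haveI : NeZero N := ⟨fun h => hpN (h ▸ dvd_zero p)⟩
  obtain ⟨f, x, hf, hgx⟩ := hg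
  -- the Serre derivative `ϑ_k f ∈ M_{k+2}(Γ₁(N))` and `k/12 ∈ ℤ_p`
  obtain ⟨ϑ, hϑ⟩ := exists_modularForm_coe_eq_serreDerivative f
  have h12 : Rat.padicValuation p (((k : ℚ) / 12 : ℚ) - (0 : ℤ)) ≤ 1 := by
    rw [Int.cast_zero, sub_zero, map_div₀, show (12 : ℚ) = ((12 : ℤ) : ℚ) by norm_num, Rat.padicValuation_cast,
      Int.padicValuation_eq_one_iff.mpr, div_one, show (k : ℚ) = ((k : ℤ) : ℚ) by norm_num]
    · exact padicValuation_intCast_le_one _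
    · intro h
      have h' : p ∣ 12 := by exact_mod_cast h
      have := Nat.le_of_dvd (by norm_num) h'
      interval_cases p <;> first | omega | exact absurd hp.out (by decide)
  obtain ⟨kc, hkc⟩ := exists_padicInt_coe_eq_of_padicValuation_le_one
    (show Rat.padicValuation p ((k : ℚ) / 12) ≤ 1 by simpa using h12)
  have hϑx := hf.serreDerivative hϑ hkc
  -- the Eisenstein series
  obtain ⟨eP, heP, heP'⟩ := exists_expansion_E_sub_one (N := N) h5 (by omega)
  obtain ⟨eQ, heQ, heQ'⟩ := exists_expansion_E_add_one (N := N) h5 (by omega)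
  -- the form `H` of weight `k + p + 1`
  have hw1 : ((p - 1 : ℕ) : ℤ) + ((k : ℤ) + 2) = ((k + p + 1 : ℕ) : ℤ) := by
    have : 1 ≤ p := hp.out.one_le
    push_cast [Nat.cast_sub this]
    ring
  have hw2 : ((p + 1 : ℕ) : ℤ) + (k : ℤ) = ((k + p + 1 : ℕ) : ℤ) := by push_cast; ring
  have hH := ((heP.mul hϑx).mcast hw1).add (((heQ.mul hf).mcast hw2).ratCast_smul hkc)
  refine ⟨_, _, hH, fun n => ?_⟩
  -- the coefficient computation mod `p`
  rw [coeff_theta, hgx n]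
  simp only [Pi.add_apply, map_add, map_sum, map_mul, map_sub, map_natCast, map_intCast, heP', heQ']
  rw [sum_antidiagonal_ite_mul]
  dsimp only
  ring

/-! ## §5 Level raising: `M̃_k(N) ⊆ M̃_k(N·M)` -/

/-- `Γ₁(N·M) ≤ Γ₁(N)`. [folklore] -/
private theorem Gamma1_mul_le (N M : ℕ) : Gamma1 (N * M) ≤ Gamma1 N := by
  intro A hA
  rw [Gamma1_mem] at hA ⊢
  obtain ⟨h1, h2, h3⟩ := hA
  refine ⟨?_, ?_, ?_⟩
  · simpa using congrArg (ZMod.castHom (dvd_mul_right N M) (ZMod N)) h1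
  · simpa using congrArg (ZMod.castHom (dvd_mul_right N M) (ZMod N)) h2
  · simpa using congrArg (ZMod.castHom (dvd_mul_right N M) (ZMod N)) h3

/-- A modular form on `Γ₁(N)` is a modular form on `Γ₁(N·M)` with the same underlying function (restriction to a subgroup).
[cite: Jochnowitz1982, §1 Def. 1.1 p. 270] -/
theorem exists_modularForm_gamma1_mul_coe_eq {k : ℤ} (f : ModularForm (Gamma1 N) k) (M : ℕ) :
    ∃ g : ModularForm (Gamma1 (N * M)) k, ⇑g = ⇑f :=
  ⟨{ toFun := f
     slash_action_eq' := fun A hA => by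
       obtain ⟨γ, hγ, rfl⟩ := hA
       exact SlashInvariantFormClass.slash_action_eq f _ ⟨γ, Gamma1_mul_le N M hγ, rfl⟩
     holo' := f.holo'
     bdd_at_cusps' := fun hc => f.bdd_at_cusps' (hc.mono fun A hA => by
       obtain ⟨γ, hγ, rfl⟩ := hA
       exact ⟨γ, Gamma1_mul_le N M hγ, rfl⟩) }, rfl⟩

/-- **`M̃_k(N) ⊆ M̃_k(N·M)`**: raising the level does not change `q`-expansions at `∞`, so Jochnowitz's spaces grow with the level.
[cite: Jochnowitz1982, §1 Def. 1.1 p. 270] -/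
theorem modPForms_le_modPForms_mul_level (k M : ℕ) : modPForms p N k ≤ modPForms p (N * M) k := by
  intro g hg
  obtain ⟨f, x, hf, hgx⟩ := hg
  obtain ⟨f', hf'⟩ := exists_modularForm_gamma1_mul_coe_eq f M
  exact ⟨f', x, fun n => by rw [hf']; exact hf n, hgx⟩

end Literature.NumberTheory.ModularForms.ModP
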